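import Mathlib
import Summits.Ventures.PercRepro2.HCov
import Summits.Ventures.PercRepro2.BHKOutside
import Summits.Ventures.PercRepro2.FirstOrderTerms

/-!
# The first-order (HCOV) at an infinitesimal pendant root is a theorem (blind cell PercRepro2, p5 g21;
`proofs/P5-OEDGE.md` §27)

With the four terms of `FirstOrderTerms.lean` (`Afo`, `Bfo`, `Cfo`, `Dfo`; `Φ = D₀·Afo + D₀·Bfo + Cfo
+ Dfo`, which is `B1/2` at a pendant root edge `{a₂, z}` whose closed pin has `a₂` isolated):

* **`Dfo_nonneg`**: explore `W = C(a₃)` under `a₁ ∉ W` (law `ρ`, positively associated by BHK06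
  Thm 1.1 = `bhk_univ_avoid`); on the fibre, Harris on `G′ ∖ W` gives
  `P(b, o ∈ C(a₁) | W) ≥ g_b(W)·g_o(W)`; the remaining functional is
  `−E_ρ[1_{z ∈ W}·(β − g_b(W))·(D₀·g_o(W) − D_o⁰)]` with `1_{z∈W}(β − g_b)` increasing and
  non-negative, `g_o` decreasing and `E_ρ[D₀·g_o] = D_o⁰` — non-negative by BHK.
* **`Phi_nonneg`**: `0 ≤ Φ`, the four terms being non-negative.

READING (P5-OEDGE.md §27): `G ≡ 0` when `C₂` is trivial, so the first-order response of `G` to an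
infinitesimal root edge is the leading term of (HCOV) there; this file proves it is non-negative
on every finite graph, with every term signed by one classical tool (monotonicity of connection
probabilities, Harris, BHK 1.1, BHK 1.4).
-/

namespace Summit.Ventures.PercRepro2

open UnionCluster

namespace CovForm

namespace FirstOrder

section DTerm

variable {V : Type*} {E : Type*} [Fintype E] [DecidableEq E] [Fintype V] [DecidableEq V]
  {R : Type*} [Field R] [LinearOrder R] [IsStrictOrderedRing R]

/-- **`Dfo ≥ 0`**: explore `W = C(a₃)` under `a₁ ∉ W`; Harris on `G′ ∖ W` bounds the joint term from
below, and BHK06 Thm 1.1 (`bhk_univ_avoid`) applied to the increasing functional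
`1_{z ∈ W}·(β − g_b(W))` and the decreasing `g_o(W)` (mean `D_o⁰/D₀` on `{a₁ ∉ W}`) signs the rest. -/
theorem Dfo_nonneg (p : E → R) (hp : IsProbVec p) (ends : E → Sym2 V) (o a₁ a₃ b z : V) :
    0 ≤ Dfo p ends o a₁ a₃ b z := by
  classical
  unfold Dfo D0 Do0
  rw [avoidAll_singleton_comm ends a₁ a₃]
  -- the four masses in `clusterInEvent` form
  have eBO : avoidAll ends a₃ {a₁} ∩ connEvent ends a₃ z ∩ connEvent ends a₁ b ∩ connEvent ends a₁ o =
      clusterInEvent ends a₃ {W | z ∈ W} ∩ clusterInEvent ends a₁ {W | b ∈ W ∧ o ∈ W} ∩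
        avoidAll ends a₃ {a₁} := by
    ext ω
    simp only [Set.mem_inter_iff, mem_connEvent, mem_clusterInEvent, Set.mem_setOf_eq, mem_cluster]
    tauto
  have eO : avoidAll ends a₃ {a₁} ∩ connEvent ends a₃ z ∩ connEvent ends a₁ o =
      clusterInEvent ends a₃ {W | z ∈ W} ∩ clusterInEvent ends a₁ {W | o ∈ W} ∩
        avoidAll ends a₃ {a₁} := by
    ext ω
    simp only [Set.mem_inter_iff, mem_connEvent, mem_clusterInEvent, Set.mem_setOf_eq, mem_cluster]
    tauto
  have eB : avoidAll ends a₃ {a₁} ∩ connEvent ends a₃ z ∩ connEvent ends a₁ b =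
      clusterInEvent ends a₃ {W | z ∈ W} ∩ clusterInEvent ends a₁ {W | b ∈ W} ∩
        avoidAll ends a₃ {a₁} := by
    ext ω
    simp only [Set.mem_inter_iff, mem_connEvent, mem_clusterInEvent, Set.mem_setOf_eq, mem_cluster]
    tauto
  have eZ : avoidAll ends a₃ {a₁} ∩ connEvent ends a₃ z =
      clusterInEvent ends a₃ {W | z ∈ W} ∩ avoidAll ends a₃ {a₁} := by
    ext ω
    simp only [Set.mem_inter_iff, mem_connEvent, mem_clusterInEvent, Set.mem_setOf_eq, mem_cluster]
    tauto
  have eDo : avoidAll ends a₃ {a₁} ∩ connEvent ends a₁ o =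
      clusterInEvent ends a₁ {W | o ∈ W} ∩ avoidAll ends a₃ {a₁} := by
    rw [← connEvent_eq_clusterInEvent]
    exact Set.inter_comm _ _
  rw [eBO, eO, eB, eZ, eDo, mass_eq_expect, mass_eq_expect, mass_eq_expect, mass_eq_expect'',
    mass_eq_expect']
  -- notation
  set C : Config E → Set V := fun ω => cluster ends ω a₃ with hC
  set iz : Config E → R := fun ω => {W : Set V | z ∈ W}.indicator 1 (C ω) with hiz
  set iR : Config E → R := fun ω => (avoidAll ends a₃ {a₁}).indicator 1 ω with hiR
  set gb : Config E → R := fun ω => delClusterProb p ends a₁ {W | b ∈ W} (C ω) with hgb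
  set go : Config E → R := fun ω => delClusterProb p ends a₁ {W | o ∈ W} (C ω) with hgo
  set gbo : Config E → R := fun ω => delClusterProb p ends a₁ {W | b ∈ W ∧ o ∈ W} (C ω) with hgbo
  set β := beta p ends a₁ b with hβ
  set d := prob p (avoidAll ends a₃ {a₁}) with hd
  -- basic signs
  have hd0 : 0 ≤ d := prob_nonneg hp _
  have hiz0 : ∀ ω, 0 ≤ iz ω := fun ω => Set.indicator_apply_nonneg fun _ => zero_le_one
  have hiR0 : ∀ ω, 0 ≤ iR ω := fun ω => Set.indicator_apply_nonneg fun _ => zero_le_one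
  have hgb0 : ∀ ω, 0 ≤ gb ω := fun ω => delClusterProb_nonneg p hp ends a₁ _ _
  have hgo0 : ∀ ω, 0 ≤ go ω := fun ω => delClusterProb_nonneg p hp ends a₁ _ _
  have hgbβ : ∀ ω, gb ω ≤ β := fun ω => delClusterProb_le_beta p hp ends a₁ b _
  -- (1) Harris on the fibre: `gb · go ≤ gbo`
  have hfib : expect p (fun ω => iz ω * (gb ω * go ω) * iR ω) ≤
      expect p (fun ω => iz ω * gbo ω * iR ω) := by
    refine expect_mono hp fun ω => ?_
    refine mul_le_mul_of_nonneg_right (mul_le_mul_of_nonneg_left ?_ (hiz0 ω)) (hiR0 ω)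
    exact delClusterProb_mul_le_inter p hp ends a₁ b o (C ω)
  -- (2) BHK for the functionals `F₁ = 1_z·(β − g_b)`, `F₂ = 1 − g_o` of `C(a₃)` under `a₁ ∉ C(a₃)`
  let F₁ : Set V → R := fun W => {W : Set V | z ∈ W}.indicator 1 W * (β - delClusterProb p ends a₁ {W | b ∈ W} W)
  let F₂ : Set V → R := fun W => 1 - delClusterProb p ends a₁ {W | o ∈ W} W
  have hgbβ' : ∀ W, delClusterProb p ends a₁ {W | b ∈ W} W ≤ β := fun W =>
    delClusterProb_le_beta p hp ends a₁ b W
  have hF₁ : Monotone F₁ := by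
    intro W W' hWW'
    simp only [F₁]
    have h1 : {W : Set V | z ∈ W}.indicator (1 : Set V → R) W ≤ {W : Set V | z ∈ W}.indicator 1 W' := by
      by_cases hz : z ∈ W
      · rw [Set.indicator_of_mem (show W ∈ {W : Set V | z ∈ W} from hz),
          Set.indicator_of_mem (show W' ∈ {W : Set V | z ∈ W} from hWW' hz)]
        simp
      · rw [Set.indicator_of_notMem (show W ∉ {W : Set V | z ∈ W} from hz)]
        exact Set.indicator_apply_nonneg fun _ => zero_le_one
    have h2 : β - delClusterProb p ends a₁ {W | b ∈ W} W ≤ β - delClusterProb p ends a₁ {W | b ∈ W} W' := by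
      have := delClusterProb_anti p hp ends a₁ (isUpperSet_mem_setOf b) hWW'
      linarith
    exact mul_le_mul h1 h2 (by linarith [hgbβ' W]) (Set.indicator_apply_nonneg fun _ => zero_le_one)
  have hF₂ : Monotone F₂ := by
    intro W W' hWW'
    simp only [F₂]
    have := delClusterProb_anti p hp ends a₁ (isUpperSet_mem_setOf o) hWW'
    linarith
  have hF₁0 : ∀ W, 0 ≤ F₁ W := fun W =>
    mul_nonneg (Set.indicator_apply_nonneg fun _ => zero_le_one) (by linarith [hgbβ' W])
  have hF₂0 : ∀ W, 0 ≤ F₂ W := fun W => by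
    simp only [F₂]
    linarith [delClusterProb_le_one p hp ends a₁ {W | o ∈ W} W]
  have key := bhk_univ_avoid p hp ends a₃ {a₁} hF₁ hF₂ hF₁0 hF₂0
  -- the three expectations of `key` in terms of the masses
  set Mz := expect p (fun ω => iz ω * iR ω) with hMz
  set Mb := expect p (fun ω => iz ω * gb ω * iR ω) with hMb
  set Mo := expect p (fun ω => iz ω * go ω * iR ω) with hMo
  set Mbo := expect p (fun ω => iz ω * gbo ω * iR ω) with hMbo
  set X := expect p (fun ω => iz ω * (gb ω * go ω) * iR ω) with hX
  set Do := expect p (fun ω => go ω * iR ω) with hDo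
  have eR : d = expect p (fun ω => iR ω) := prob_eq_expect_indicator p _
  have e1 : expect p (fun ω => F₁ (cluster ends ω a₃) * (avoidAll ends a₃ {a₁}).indicator 1 ω) =
      β * Mz - Mb := by
    rw [hMz, hMb, ← expect_const_mul, ← expect_sub]
    exact congrArg (expect p) (funext fun ω => by simp only [F₁, Pi.sub_apply, iz, iR, gb, C]; ring)
  have e2 : expect p (fun ω => F₂ (cluster ends ω a₃) * (avoidAll ends a₃ {a₁}).indicator 1 ω) =
      d - Do := by
    rw [eR, hDo, ← expect_sub]
    exact congrArg (expect p) (funext fun ω => by simp only [F₂, Pi.sub_apply, iR, go, C]; ring)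
  have e3 : expect p (fun ω => F₁ (cluster ends ω a₃) * F₂ (cluster ends ω a₃) *
      (avoidAll ends a₃ {a₁}).indicator 1 ω) = β * Mz - Mb - β * Mo + X := by
    rw [hMz, hMb, hMo, hX, ← expect_const_mul, ← expect_const_mul, ← expect_sub, ← expect_sub,
      ← expect_add]
    exact congrArg (expect p) (funext fun ω => by
      simp only [F₁, F₂, Pi.sub_apply, Pi.add_apply, iz, iR, gb, go, C]; ring)
  rw [e1, e2, e3] at key
  -- assemble
  nlinarith [key, hfib, hd0]

end DTerm

section Main

variable {V : Type*} {E : Type*} [Fintype E] [DecidableEq E] [Fintype V] [DecidableEq V]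
  {R : Type*} [Field R] [LinearOrder R] [IsStrictOrderedRing R]

/-- **THE FIRST-ORDER (HCOV) IS A THEOREM**: `0 ≤ Φ = D₀·Afo + D₀·Bfo + Cfo + Dfo` on every finite
graph, every weight vector and every choice of `o, a₁, a₃, b, z` — each of the four terms is
non-negative (`Afo_nonneg`, `Bfo_nonneg`, `Cfo_nonneg`, `Dfo_nonneg`). -/
theorem Phi_nonneg (p : E → R) (hp : IsProbVec p) (ends : E → Sym2 V) (o a₁ a₃ b z : V) :
    0 ≤ Phi p ends o a₁ a₃ b z := by
  unfold Phi
  have hd : 0 ≤ D0 p ends a₁ a₃ := prob_nonneg hp _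
  have hA := Afo_nonneg p hp ends o a₁ a₃ b z
  have hB := Bfo_nonneg p hp ends o a₁ a₃ b z
  have hC := Cfo_nonneg p hp ends o a₁ a₃ b z
  have hD := Dfo_nonneg p hp ends o a₁ a₃ b z
  have := mul_nonneg hd hA
  have := mul_nonneg hd hB
  linarith

end Main

end FirstOrder

end CovForm

end Summit.Ventures.PercRepro2
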